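import Summits.CriticalPhenomena.PercolationContinuityZ3.Theorems.SahiPositivityWeakLimits
import Mathlib.Topology.MetricSpace.PiNat

/-!
# Sahi positivity of order `n` is weakly closed: pseudo-metric ordered spaces and countable products

Support file of the Sahi cell (`prim-sahi`, typer seat, generation 14; `--supports stmt-CriticalPhenomena-4575`).
Theorems only (no definitions, no named facts, no sorries).  Companion of `SahiPositivityWeakLimits.lean`
(finite products) extending "continuous monotone test families suffice / weak limits of order-`n` Sahi-positive
laws are order-`n` Sahi-positive" to INFINITE products — the Hilbert cube `[0,1]^ℕ`, `ℝ^ℕ`, and any countable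
product of (R1) metric chains — i.e. to the infinite-volume setting of the cell's box-TP₂ theorems
(`SahiBoxTP2HilbertPositivity.lean`, `SahiBoxTP2WeakLimitsHilbert.lean`).

* Abstract core on a pseudo-metric partially ordered space in which the distance to every increasing set is
  non-increasing along the order (`hanti`): `msahiE_indicator_nonneg_of_continuous_of_isClosed'` (closed up-sets),
  `msahiE_indicator_nonneg_of_continuous'` (measurable up-sets; closed order, inner regularity by compacts),
  `msahiE_nonneg_of_continuous'` (all bounded measurable nonnegative monotone families),
  `msahiE_nonneg_of_tendsto_of_continuous'` (weak limits).
* `infDist_antitone_of_isUpperSet_piCountable` — `hanti` holds for a COUNTABLE product of (R1) metric chains with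
  Mathlib's (scoped, topology-compatible) product distance `PiCountable.dist`
  (`dist x y = Σ_i min(2^{-i}, dist (x_i) (y_i))`).
* Instances: `msahiE_nonneg_of_continuous_piCountable`, `msahiE_nonneg_of_tendsto_piCountable` (any countable
  product of (R1) metric chains, bounded families); the Hilbert cube `msahiE_nonneg_of_continuous_hilbertCube`,
  `msahiE_nonneg_of_tendsto_hilbertCube` (ALL measurable nonnegative monotone families); `ℝ^ℕ`
  `msahiE_nonneg_of_tendsto_realSeq`.

No sorries, no new axioms.
-/

noncomputable section

namespace Summit.CriticalPhenomena.PercolationContinuityZ3.Theorems.SahiWeakLimits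

open MeasureTheory Set Filter Topology Function Literature.Combinatorics.Sahi2008
open scoped ENNReal unitInterval

/-! ### Abstract core: pseudo-metric ordered spaces with antitone distance to up-sets -/

section Abstract

variable {Ω : Type*} [PseudoMetricSpace Ω] [PartialOrder Ω] [MeasurableSpace Ω] [OpensMeasurableSpace Ω]

omit [MeasurableSpace Ω] [OpensMeasurableSpace Ω] in
/-- Monotonicity of the approximants `max(0, 1 − m·d(·,C))` of an increasing set when the distance to increasing
sets is non-increasing. [folklore] -/
theorem monotone_upApprox' (hanti : ∀ C : Set Ω, IsUpperSet C → ∀ ⦃x y : Ω⦄, x ≤ y →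
      Metric.infDist y C ≤ Metric.infDist x C) {C : Set Ω} (hC : IsUpperSet C) (m : ℕ) :
    Monotone fun x : Ω => max 0 (1 - (m : ℝ) * Metric.infDist x C) := fun _ _ hxy =>
  max_le_max le_rfl (sub_le_sub_left (mul_le_mul_of_nonneg_left (hanti C hC hxy) (Nat.cast_nonneg m)) 1)

/-- **Step 1 (abstract) — closed up-sets.** [this work] -/
theorem msahiE_indicator_nonneg_of_continuous_of_isClosed'
    (hanti : ∀ C : Set Ω, IsUpperSet C → ∀ ⦃x y : Ω⦄, x ≤ y → Metric.infDist y C ≤ Metric.infDist x C)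
    (μ : Measure Ω) [IsFiniteMeasure μ] {n : ℕ}
    (h : ∀ g : Fin n → Ω → ℝ, (∀ i, Continuous (g i)) → (∀ i, Monotone (g i)) →
      (∀ i x, 0 ≤ g i x) → (∀ i x, g i x ≤ 1) → 0 ≤ msahiE μ n g)
    (U : Fin n → Set Ω) (hUc : ∀ i, IsClosed (U i)) (hUu : ∀ i, IsUpperSet (U i)) :
    0 ≤ msahiE μ n fun i => (U i).indicator 1 := by
  by_cases hne : ∀ i, (U i).Nonempty
  · refine msahiE_nonneg_of_tendsto μ (fun m i x => max 0 (1 - (m : ℝ) * Metric.infDist x (U i))) _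
      (fun m i => (continuous_upApprox (U i) m).measurable) (C := 1) (fun m i x => ?_)
      (fun i x => tendsto_upApprox (hUc i) (hne i) x)
      (fun m => h _ (fun i => continuous_upApprox (U i) m) (fun i => monotone_upApprox' hanti (hUu i) m)
        (fun i x => le_max_left _ _) fun i x => ?_)
    · rw [abs_of_nonneg (le_max_left _ _)]
      exact max_le zero_le_one (sub_le_self _ (mul_nonneg (Nat.cast_nonneg m) Metric.infDist_nonneg))
    · exact max_le zero_le_one (sub_le_self _ (mul_nonneg (Nat.cast_nonneg m) Metric.infDist_nonneg))
  · push Not at hne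
    obtain ⟨i, hi⟩ := hne
    have hz : (fun j => (U j).indicator (1 : Ω → ℝ)) i = 0 := by
      funext x
      simp only [hi, Set.indicator_empty, Pi.zero_apply]
    rw [msahiE_eq_zero_of_slot_zero μ _ hz]

variable [OrderClosedTopology Ω]

/-- **Step 2 (abstract) — measurable up-sets** (closed order; `μ` inner regular by compact sets). [this work] -/
theorem msahiE_indicator_nonneg_of_continuous'
    (hanti : ∀ C : Set Ω, IsUpperSet C → ∀ ⦃x y : Ω⦄, x ≤ y → Metric.infDist y C ≤ Metric.infDist x C)
    (μ : Measure Ω) [IsFiniteMeasure μ] [μ.InnerRegularCompactLTTop] {n : ℕ}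
    (h : ∀ g : Fin n → Ω → ℝ, (∀ i, Continuous (g i)) → (∀ i, Monotone (g i)) →
      (∀ i x, 0 ≤ g i x) → (∀ i x, g i x ≤ 1) → 0 ≤ msahiE μ n g)
    (U : Fin n → Set Ω) (hUm : ∀ i, MeasurableSet (U i)) (hUu : ∀ i, IsUpperSet (U i)) :
    0 ≤ msahiE μ n fun i => (U i).indicator 1 := by
  have key : ∀ i (m : ℕ), ∃ K, K ⊆ U i ∧ IsCompact K ∧ μ (U i \ K) < ((m : ℝ≥0∞) + 1)⁻¹ := fun i m =>
    (hUm i).exists_isCompact_sdiff_lt (measure_ne_top μ _)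
      (ENNReal.inv_ne_zero.2 (by exact ENNReal.add_ne_top.2 ⟨ENNReal.natCast_ne_top m, ENNReal.one_ne_top⟩))
  choose K hKU hKc hKμ using key
  set C : Fin n → ℕ → Set Ω := fun i m => (upperClosure (accumulate (K i) m) : Set Ω) with hCdef
  have hCc : ∀ i m, IsClosed (C i m) := fun i m =>
    Literature.Probability.Percolation.isClosed_upperClosure_of_isCompact (isCompact_accumulate (hKc i) m)
  have hCu : ∀ i m, IsUpperSet (C i m) := fun i m => (upperClosure _).upper
  have hCU : ∀ i m, C i m ⊆ U i := fun i m x hx => by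
    obtain ⟨a, ha, hax⟩ := mem_upperClosure.1 hx
    obtain ⟨j, -, hj⟩ := mem_accumulate.1 ha
    exact hUu i hax (hKU i j hj)
  have hCmono : ∀ i, Monotone (C i) := fun i m m' hmm' => coe_upperClosure_mono (monotone_accumulate hmm')
  have hKC : ∀ i m, K i m ⊆ C i m := fun i m => (subset_accumulate (s := K i)).trans subset_upperClosure
  set V : Fin n → Set Ω := fun i => ⋃ m, C i m with hVdef
  have hVU : ∀ i, V i ⊆ U i := fun i => iUnion_subset fun m => hCU i m
  have hposV : 0 ≤ msahiE μ n fun i => (V i).indicator 1 := by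
    refine msahiE_nonneg_of_tendsto μ (fun m i => (C i m).indicator 1) _
      (fun m i => (measurable_one.indicator (hCc i m).measurableSet)) (C := 1) (fun m i x => ?_)
      (fun i x => tendsto_indicator_of_monotone (hCmono i) x)
      (fun m => msahiE_indicator_nonneg_of_continuous_of_isClosed' hanti μ h (fun i => C i m)
        (fun i => hCc i m) fun i => hCu i m)
    by_cases hx : x ∈ C i m
    · simp [Set.indicator_of_mem hx]
    · simp [Set.indicator_of_notMem hx]
  have hnull : ∀ i, μ (U i \ V i) = 0 := by
    intro i
    by_contra h0
    obtain ⟨N, hN⟩ := ENNReal.exists_inv_nat_lt h0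
    have h1 : μ (U i \ V i) ≤ μ (U i \ K i N) :=
      measure_mono (sdiff_subset_sdiff_right ((hKC i N).trans (subset_iUnion (C i) N)))
    have h2 : ((N : ℝ≥0∞) + 1)⁻¹ ≤ (N : ℝ≥0∞)⁻¹ := ENNReal.inv_le_inv.2 le_self_add
    exact (lt_irrefl _) ((hN.trans_le h1).trans (hKμ i N) |>.trans_le h2)
  have hae : ∀ i, (U i).indicator (1 : Ω → ℝ) =ᵐ[μ] (V i).indicator 1 := by
    intro i
    refine indicator_ae_eq_of_ae_eq_set ((ae_eq_set).2 ⟨hnull i, ?_⟩)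
    rw [sdiff_eq_empty.2 (hVU i), measure_empty]
  rw [msahiE_congr_of_moments μ μ (fun i => (U i).indicator 1) (fun i => (V i).indicator 1) fun S => ?_]
  · exact hposV
  refine integral_congr_ae ?_
  have hall : ∀ᵐ x ∂μ, ∀ i, (U i).indicator (1 : Ω → ℝ) x = (V i).indicator 1 x := ae_all_iff.2 fun i => hae i
  filter_upwards [hall] with x hx
  simp only [Finset.prod_apply]
  exact Finset.prod_congr rfl fun i _ => hx i

/-- **Step 3 (abstract) — continuous monotone test families suffice for Sahi positivity of order `n`** on a
pseudo-metric partially ordered space with closed order and antitone distance to up-sets (finite measure, inner regular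
by compact sets): positivity on continuous monotone `[0,1]`-valued families gives positivity on all bounded
measurable nonnegative monotone families. [this work] -/
theorem msahiE_nonneg_of_continuous'
    (hanti : ∀ C : Set Ω, IsUpperSet C → ∀ ⦃x y : Ω⦄, x ≤ y → Metric.infDist y C ≤ Metric.infDist x C)
    (μ : Measure Ω) [IsFiniteMeasure μ] [μ.InnerRegularCompactLTTop] {n : ℕ}
    (h : ∀ g : Fin n → Ω → ℝ, (∀ i, Continuous (g i)) → (∀ i, Monotone (g i)) →
      (∀ i x, 0 ≤ g i x) → (∀ i x, g i x ≤ 1) → 0 ≤ msahiE μ n g)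
    (f : Fin n → Ω → ℝ) (hfm : ∀ i, Measurable (f i)) (hf0 : ∀ i x, 0 ≤ f i x) {B : ℝ}
    (hfB : ∀ i x, f i x ≤ B) (hmono : ∀ i, Monotone (f i)) : 0 ≤ msahiE μ n f :=
  msahiE_nonneg_of_upperSets μ (fun U hUu hUm => msahiE_indicator_nonneg_of_continuous' hanti μ h U hUm hUu)
    f hf0 hfB hmono fun i _ => measurableSet_lt measurable_const (hfm i)

/-- **Weak limits (abstract)**: if probability measures `μ_k → μ` weakly and each `μ_k` has `E_n ≥ 0` on continuous
monotone `[0,1]`-valued families, then `μ` has `E_n ≥ 0` on all bounded measurable nonnegative monotone families.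
[this work] -/
theorem msahiE_nonneg_of_tendsto_of_continuous'
    (hanti : ∀ C : Set Ω, IsUpperSet C → ∀ ⦃x y : Ω⦄, x ≤ y → Metric.infDist y C ≤ Metric.infDist x C)
    {ι : Type*} {L : Filter ι} [NeBot L] {μs : ι → ProbabilityMeasure Ω} {μ : ProbabilityMeasure Ω}
    (hconv : Tendsto μs L (𝓝 μ)) [(μ : Measure Ω).InnerRegularCompactLTTop] {n : ℕ}
    (h : ∀ᶠ k in L, ∀ g : Fin n → Ω → ℝ, (∀ i, Continuous (g i)) → (∀ i, Monotone (g i)) →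
      (∀ i x, 0 ≤ g i x) → (∀ i x, g i x ≤ 1) → 0 ≤ msahiE (μs k : Measure Ω) n g)
    (f : Fin n → Ω → ℝ) (hfm : ∀ i, Measurable (f i)) (hf0 : ∀ i x, 0 ≤ f i x) {B : ℝ}
    (hfB : ∀ i x, f i x ≤ B) (hmono : ∀ i, Monotone (f i)) : 0 ≤ msahiE (μ : Measure Ω) n f :=
  msahiE_nonneg_of_continuous' hanti (μ : Measure Ω)
    (fun g hgc hgm hg0 hg1 => msahiE_nonneg_of_tendsto_probabilityMeasure hconv g hgc
      (fun i => ⟨1, fun x => by rw [abs_of_nonneg (hg0 i x)]; exact hg1 i x⟩)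
      (h.mono fun k hk => hk g hgc hgm hg0 hg1))
    f hfm hf0 hfB hmono

end Abstract

/-! ### Countable products of (R1) metric chains with the product distance `Σ min(2^{-i}, d_i)` -/

section PiCountable

open scoped PiCountable

variable {ι : Type*} [Encodable ι] {F : ι → Type*} [∀ i, LinearOrder (F i)] [∀ i, PseudoMetricSpace (F i)]

/-- **In a countable product of (R1) metric chains** (`dist a (a ⊔ b) ≤ dist c b` for `c ≤ a` in each factor),
equipped with Mathlib's product distance `dist x y = Σ_i min(2^{-i}, dist (x_i) (y_i))`, **the distance to an
increasing set is non-increasing along the order.** [folklore; cite: Lindqvist1988, §2 (R1)] -/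
theorem infDist_antitone_of_isUpperSet_piCountable
    (hF : ∀ i (a b c : F i), c ≤ a → dist a (a ⊔ b) ≤ dist c b) {C : Set (∀ i, F i)} (hC : IsUpperSet C)
    {x y : ∀ i, F i} (hxy : x ≤ y) : Metric.infDist y C ≤ Metric.infDist x C := by
  rcases C.eq_empty_or_nonempty with rfl | hne
  · simp [Metric.infDist_empty]
  refine le_of_forall_pos_lt_add fun ε hε => ?_
  obtain ⟨z, hzC, hz⟩ := (Metric.infDist_lt_iff hne).1 (lt_add_of_pos_right (Metric.infDist x C) hε)
  have hyz : y ⊔ z ∈ C := hC le_sup_right hzC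
  calc Metric.infDist y C ≤ dist y (y ⊔ z) := Metric.infDist_le_dist_of_mem hyz
    _ ≤ dist x z := by
        rw [PiCountable.dist_eq_tsum, PiCountable.dist_eq_tsum]
        refine (PiCountable.dist_summable y (y ⊔ z)).tsum_le_tsum (fun i => ?_) (PiCountable.dist_summable x z)
        refine min_le_min le_rfl ?_
        rw [Pi.sup_apply]
        exact hF i (y i) (z i) (x i) (hxy i)
    _ < Metric.infDist x C + ε := hz

variable [∀ i, MeasurableSpace (F i)] [∀ i, BorelSpace (F i)] [∀ i, SecondCountableTopology (F i)]
  [∀ i, OrderClosedTopology (F i)]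

/-- **Continuous monotone test families suffice on a countable product of (R1) metric chains** (finite measure,
inner regular by compact sets — automatic when the factors are Polish): positivity of `E_n` on continuous
monotone `[0,1]`-valued families gives it on all bounded measurable nonnegative monotone families. [this work] -/
theorem msahiE_nonneg_of_continuous_piCountable
    (hF : ∀ i (a b c : F i), c ≤ a → dist a (a ⊔ b) ≤ dist c b) (μ : Measure (∀ i, F i)) [IsFiniteMeasure μ]
    [μ.InnerRegularCompactLTTop] {n : ℕ}
    (h : ∀ g : Fin n → (∀ i, F i) → ℝ, (∀ i, Continuous (g i)) → (∀ i, Monotone (g i)) →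
      (∀ i x, 0 ≤ g i x) → (∀ i x, g i x ≤ 1) → 0 ≤ msahiE μ n g)
    (f : Fin n → (∀ i, F i) → ℝ) (hfm : ∀ i, Measurable (f i)) (hf0 : ∀ i x, 0 ≤ f i x) {B : ℝ}
    (hfB : ∀ i x, f i x ≤ B) (hmono : ∀ i, Monotone (f i)) : 0 ≤ msahiE μ n f :=
  msahiE_nonneg_of_continuous' (fun _ hC _ _ hxy => infDist_antitone_of_isUpperSet_piCountable hF hC hxy) μ h f
    hfm hf0 hfB hmono

/-- **Weak limits of order-`n` Sahi-positive laws on a countable product of (R1) metric chains are order-`n`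
Sahi-positive** (bounded measurable nonnegative monotone families). [this work] -/
theorem msahiE_nonneg_of_tendsto_piCountable
    (hF : ∀ i (a b c : F i), c ≤ a → dist a (a ⊔ b) ≤ dist c b) {κ : Type*} {L : Filter κ} [NeBot L]
    {μs : κ → ProbabilityMeasure (∀ i, F i)} {μ : ProbabilityMeasure (∀ i, F i)} (hconv : Tendsto μs L (𝓝 μ))
    [(μ : Measure (∀ i, F i)).InnerRegularCompactLTTop] {n : ℕ}
    (h : ∀ᶠ k in L, ∀ g : Fin n → (∀ i, F i) → ℝ, (∀ i, Continuous (g i)) → (∀ i, Monotone (g i)) →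
      (∀ i x, 0 ≤ g i x) → (∀ i x, g i x ≤ 1) → 0 ≤ msahiE (μs k : Measure (∀ i, F i)) n g)
    (f : Fin n → (∀ i, F i) → ℝ) (hfm : ∀ i, Measurable (f i)) (hf0 : ∀ i x, 0 ≤ f i x) {B : ℝ}
    (hfB : ∀ i x, f i x ≤ B) (hmono : ∀ i, Monotone (f i)) : 0 ≤ msahiE (μ : Measure (∀ i, F i)) n f :=
  msahiE_nonneg_of_tendsto_of_continuous'
    (fun _ hC _ _ hxy => infDist_antitone_of_isUpperSet_piCountable hF hC hxy) hconv h f hfm hf0 hfB hmono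

end PiCountable

/-! ### The Hilbert cube `[0,1]^ℕ` and `ℝ^ℕ` -/

section Instances

variable {n : ℕ} {κ : Type*} {L : Filter κ} [NeBot L]

/-- **The Hilbert cube: continuous monotone test families suffice** — a finite measure on `[0,1]^ℕ` with `E_n ≥ 0`
on continuous monotone `[0,1]`-valued families has `E_n ≥ 0` on ALL measurable nonnegative monotone families.
[this work] -/
theorem msahiE_nonneg_of_continuous_hilbertCube (μ : Measure (ℕ → I)) [IsFiniteMeasure μ]
    (h : ∀ g : Fin n → (ℕ → I) → ℝ, (∀ i, Continuous (g i)) → (∀ i, Monotone (g i)) →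
      (∀ i x, 0 ≤ g i x) → (∀ i x, g i x ≤ 1) → 0 ≤ msahiE μ n g)
    (f : Fin n → (ℕ → I) → ℝ) (hfm : ∀ i, Measurable (f i)) (hf0 : ∀ i x, 0 ≤ f i x)
    (hmono : ∀ i, Monotone (f i)) : 0 ≤ msahiE μ n f := by
  refine msahiE_nonneg_of_continuous_piCountable (F := fun _ : ℕ => I)
    (fun _ a b c hca => subtype_dist_sup_le a b c hca) μ h f hfm hf0 (B := ∑ j, f j fun _ => 1) (fun i x => ?_)
    hmono
  exact (hmono i fun k => unitInterval.le_one (x k)).trans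
    (Finset.single_le_sum (fun j _ => hf0 j _) (Finset.mem_univ i))

/-- **The Hilbert cube: weak limits of order-`n` Sahi-positive probability measures are order-`n` Sahi-positive**
(all measurable nonnegative monotone families). [this work] -/
theorem msahiE_nonneg_of_tendsto_hilbertCube {μs : κ → ProbabilityMeasure (ℕ → I)}
    {μ : ProbabilityMeasure (ℕ → I)} (hconv : Tendsto μs L (𝓝 μ))
    (h : ∀ᶠ k in L, ∀ g : Fin n → (ℕ → I) → ℝ, (∀ i, Continuous (g i)) → (∀ i, Monotone (g i)) →
      (∀ i x, 0 ≤ g i x) → (∀ i x, g i x ≤ 1) → 0 ≤ msahiE (μs k : Measure (ℕ → I)) n g)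
    (f : Fin n → (ℕ → I) → ℝ) (hfm : ∀ i, Measurable (f i)) (hf0 : ∀ i x, 0 ≤ f i x)
    (hmono : ∀ i, Monotone (f i)) : 0 ≤ msahiE (μ : Measure (ℕ → I)) n f :=
  msahiE_nonneg_of_continuous_hilbertCube (μ : Measure (ℕ → I))
    (fun g hgc hgm hg0 hg1 => msahiE_nonneg_of_tendsto_probabilityMeasure hconv g hgc
      (fun i => ⟨1, fun x => by rw [abs_of_nonneg (hg0 i x)]; exact hg1 i x⟩)
      (h.mono fun k hk => hk g hgc hgm hg0 hg1))
    f hfm hf0 hmono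

/-- The same with the weaker hypothesis that each `μ_k` is Sahi-positive of order `n` on all MEASURABLE
nonnegative monotone families (e.g. the conclusion of `msahiE_nonneg_of_isBoxTP2_hilbert`). [this work] -/
theorem msahiE_nonneg_of_tendsto_hilbertCube' {μs : κ → ProbabilityMeasure (ℕ → I)}
    {μ : ProbabilityMeasure (ℕ → I)} (hconv : Tendsto μs L (𝓝 μ))
    (h : ∀ᶠ k in L, ∀ g : Fin n → (ℕ → I) → ℝ, (∀ i, Measurable (g i)) → (∀ i, Monotone (g i)) →
      (∀ i x, 0 ≤ g i x) → 0 ≤ msahiE (μs k : Measure (ℕ → I)) n g)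
    (f : Fin n → (ℕ → I) → ℝ) (hfm : ∀ i, Measurable (f i)) (hf0 : ∀ i x, 0 ≤ f i x)
    (hmono : ∀ i, Monotone (f i)) : 0 ≤ msahiE (μ : Measure (ℕ → I)) n f :=
  msahiE_nonneg_of_tendsto_hilbertCube hconv
    (h.mono fun _ hk g hgc hgm hg0 _ => hk g (fun i => (hgc i).measurable) hgm hg0) f hfm hf0 hmono

/-- **`ℝ^ℕ`: weak limits of order-`n` Sahi-positive probability measures are order-`n` Sahi-positive** (bounded
measurable nonnegative monotone families; e.g. infinite-volume limits of lattice-field measures). [this work] -/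
theorem msahiE_nonneg_of_tendsto_realSeq {μs : κ → ProbabilityMeasure (ℕ → ℝ)}
    {μ : ProbabilityMeasure (ℕ → ℝ)} (hconv : Tendsto μs L (𝓝 μ))
    (h : ∀ᶠ k in L, ∀ g : Fin n → (ℕ → ℝ) → ℝ, (∀ i, Continuous (g i)) → (∀ i, Monotone (g i)) →
      (∀ i x, 0 ≤ g i x) → (∀ i x, g i x ≤ 1) → 0 ≤ msahiE (μs k : Measure (ℕ → ℝ)) n g)
    (f : Fin n → (ℕ → ℝ) → ℝ) (hfm : ∀ i, Measurable (f i)) (hf0 : ∀ i x, 0 ≤ f i x) {B : ℝ}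
    (hfB : ∀ i x, f i x ≤ B) (hmono : ∀ i, Monotone (f i)) : 0 ≤ msahiE (μ : Measure (ℕ → ℝ)) n f :=
  msahiE_nonneg_of_tendsto_piCountable (F := fun _ : ℕ => ℝ) (fun _ a b c hca => real_dist_sup_le a b c hca)
    hconv h f hfm hf0 hfB hmono

end Instances

end Summit.CriticalPhenomena.PercolationContinuityZ3.Theorems.SahiWeakLimits
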